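import Literature.MathematicalPhysics.QuantumFieldTheory.Balaban1983to89.B6Partition118KLevelTorusCentralL0
/-!
# `Balaban1983to89.B6Partition118KLevelTorusWindowL0` — LEVEL-0 TWIN (programme G-F3′-L0, director-ym LINE №27 / UV3-NODE §24.5; plan `lit-balaban-r03/G-F3L0-PLAN.md`) of `B6Partition118KLevelTorusWindow`:
the same declarations, SAME NAMES AND STATEMENTS, for nested families WITH print's region `Λ₀ = T ∖ Ω₁` ADMITTED (structures
`B6MultiLevelBoxOperatorL0.Domains` / `B6MultiLevelTorusOperatorL0.TDomains`: levels `0, …, k`, the level-`0` block a single site, `Q′₀ = id`,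
finite weight `a₀` — print p.225 (2.14) «Σ_{j=0}^k … (Q′₀λ)(x) = λ(x), x ∈ Λ₀», p.229 «taking a sequence (2.1) … smallest possible domains B^j(Λ_j),
and considering the operator Δ_a defined by (2.19), (2.20) for this sequence»).  Every `D`-free object is the lineage's, consumed BY NAME; no existing
module is touched; no fact is minted.  Unit `lit-balaban-r03` (B6 fold owner, r03 gen 36); referee ref-4.  THE TWIN'S DOCUMENTATION FOLLOWS
VERBATIM (its «levels 1 … k» / «Ω₁ = X» sentences describe the twin; here `j` runs from `0` and `Ω₁` may be a proper subset).

# `Balaban1983to89.B6Partition118KLevelTorusWindow` — T. Bałaban, *Propagators and renormalization transformations for lattice gauge theories. II*,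
# Commun. Math. Phys. **96** (1984) 223–250 [Balaban1984PropagatorsII], (2.2) p. 224, (2.36) p. 229, p. 238–239 (the windows `□̃³` of Prop. 2.6): THE
# RADIUS-PARAMETRIC TWO-LEVEL WINDOW AND DEPTH OF A BALL AROUND THE CENTRAL CUBE of the canonical chart of a torus cube — `(ρ + S_j/2)·L ≤ R·S_j ⟹` every
# chart site within `ρ` of the centre has level `j₀` or `j₀ + 1` for one `j₀ ∈ {j − 1, j}` ((2.2) at the cube's witness), and the sites of the `ρ`-ball are
# `w`-deep whenever `ρ + w` fits under the centre bounds (file 5 of route (A) of B6-CLOSURE §5 item 11; r03 g19's request for the member windows of (d5-b))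

statement-level skeleton of published theorems with citation tags; proofs where landed; nothing here is a claim about the Yang–Mills mass gap

PDF held: `paper:balaban1984-cmp96-propagators-rt-ii` (journal page = PDF page + 222): p. 224 [PDF 2] ((2.2): *"(L^jη)^{−1}dist(Ω_j^c, Ω_{j+1}) > RM"*), p. 230
[PDF 8] (*"□ … intersecting maybe the domain B^{j+1}(Λ_{j+1})"*), p. 238 [PDF 16] (*"we take the cube □̃³ and identify it with a torus T_□"*); read from the tree
transcriptions in `…B6MultiLevelBoxOperator` (p21, `B6MultiLevelBoxOperator.Domains.sep`/`lev_window`/`not_both_sides`) and `…B6Partition118KLevelTorusCentral`.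

CITATION HEADER (lean-in-tree rule) — WHAT IS REPRODUCED.  Phase-2 file of the `lit-balaban` typed skeleton (HOME `run/shared/lean/pub/lit-balaban/`), seat
**p38 gen 26**; SKELETON rows **B6.Eq2.2** × **B6.Eq2.36** × **B6.Prop2.6** (cells only; decls of record untouched; owner r03, referee ref-4).  File 3
(`…Central`) gave the two-level window and the `S_k`-depth of the FIXED `3S_j/2`-collar of the central cube `cc c`; r03's member window of Prop. 2.6 (one full
period of the member torus `T_□`, up to `≈ 7L·S_j` above the centre; `…B6IndexCorrV1.hagree_domT`'s `hlev`, `…B6FullWindowReachV1`) needs both facts on a ball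
of ARBITRARY radius `ρ`, with the (2.2)-constant `R` and the room in the chart as explicit hypotheses (r03 g19, 2026-08-23T03:16:38Z).  THIS FILE:
* §1 **`two_level_ball`**: `(ρ + S_j/2)·L ≤ R·S_j ⟹ ∃ j₀ ∈ {j − 1, j}, ∀ w, dist(w, ctr) ≤ ρ → j₀ ≤ lev w ≤ j₀ + 1` — (2.2) `B6MultiLevelBoxOperator.Domains.sep` of the chart family
  at levels `j − 1`, `j + 1` (against the cube's witness, a level-`j` site within `S_j/2` of the centre) and `j` (no two sites of levels `j − 1` and `j + 1` in
  the ball); `lev_ge_of_dist_le`/`lev_le_of_dist_le` are the one-sided halves; the torus reading is file 3's `lev_σch`;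
* §2 **`siteDeep_of_dist_le_of_room`**: `ρ + w ≤ 2S_k + S_j/2` and `ρ + w ≤ (P_μ − 3)S_k + S_j/2 ⟹` every chart site within `ρ` of the centre is `w`-deep
  (file 3's `ctr_cc_bounds`), and `blkDeep_of_room` for a block all of whose sites lie in the ball.
No `def`, no new fact; standard axioms.
HONEST SCOPE. Pure bookkeeping on p21's integer box/torus; the radius, the depth and the largeness of `R` are the consumer's inputs (print: `R` large,
(2.2)); `P_μ ≥ 4`; NOT summit progress.  Unit `lit-balaban-p38` (gen 26), 2026-08-23.
-/

namespace Literature.MathematicalPhysics.QuantumFieldTheory.Balaban1983to89.B6Partition118KLevelTorusWindowL0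

open Literature.MathematicalPhysics.QuantumFieldTheory.Balaban1983to89.B4ContourShift (supNorm)
open Literature.MathematicalPhysics.QuantumFieldTheory.Balaban1983to89.B4Reflection242 (boxDom mem_boxDom)
open Literature.MathematicalPhysics.QuantumFieldTheory.Balaban1983to89.B6MultiLevelBoxOperator (N0 bigSide bigSide_succ one_le_bigSide)
open Literature.MathematicalPhysics.QuantumFieldTheory.Balaban1983to89.B6MultiLevelBoxOperatorL0 (Domains)
open Literature.MathematicalPhysics.QuantumFieldTheory.Balaban1983to89.B6MultiLevelTorusOperatorL0 (TDomains)
open Literature.MathematicalPhysics.QuantumFieldTheory.Balaban1983to89.B6Geom246MultiLevelBox (toR supNorm_eq_dist)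
open Literature.MathematicalPhysics.QuantumFieldTheory.Balaban1983to89.B6Geom246MultiLevelBoxL0 (bset blkOf)
open Literature.MathematicalPhysics.QuantumFieldTheory.Balaban1983to89.B6Cover236MultiLevelBlocksL0 (cubes ctr wit lev_wit blk_wit dist_toR_ctr_le)
open Literature.MathematicalPhysics.QuantumFieldTheory.Balaban1983to89.B6TorusDepthDistance (SiteDeep)
open Literature.MathematicalPhysics.QuantumFieldTheory.Balaban1983to89.B6TorusDepthDistanceL0 (BlkDeep)
open Literature.MathematicalPhysics.QuantumFieldTheory.Balaban1983to89.B6Partition118KLevelTorusCentralL0 (Dch cc side_cc ctr_cc_bounds level_bounds)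

variable {d : ℕ} {ℓ Mh k R : ℕ} {P : Fin (d + 1) → ℕ} {D : TDomains d ℓ Mh k P R}

/-! ## §1  The two-level window of a ball around the central cube -/

/-- a chart site within `ρ` of the centre of the central cube is within `ρ + S_j/2` (sup norm) of the cube's witness (a level-`j` chart site of the big block).
[cite: Balaban1984PropagatorsII, p.229 («with a center y ∈ Λ_j»), bookkeeping] -/
theorem supNorm_sub_wit_le (hMh : 1 ≤ Mh) (hP4 : ∀ μ, 4 ≤ P μ) (c : ↥(B6Cover236MultiLevelBlocksL0.cubes D.toDomains)) {ρ : ℝ} {w : ↥(boxDom (N0 ℓ Mh k P))}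
    (hw : dist (toR w.1) (ctr (Dch D c) (cc D hMh hP4 c)) ≤ ρ) :
    supNorm (w.1 - (wit (Dch D c) (cc D hMh hP4 c)).1) ≤ ρ + (bigSide ℓ Mh c.1.1 : ℝ) / 2 := by
  have hwit : dist (toR (wit (Dch D c) (cc D hMh hP4 c)).1) (ctr (Dch D c) (cc D hMh hP4 c)) ≤ (bigSide ℓ Mh c.1.1 : ℝ) / 2 := by
    rw [← side_cc hMh hP4 c]; exact dist_toR_ctr_le (Dch D c) hMh (blk_wit (Dch D c) (cc D hMh hP4 c))
  rw [supNorm_eq_dist]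
  linarith [dist_triangle_right (toR w.1) (toR (wit (Dch D c) (cc D hMh hP4 c)).1) (ctr (Dch D c) (cc D hMh hP4 c))]

/-- **LEVELS `≥ j − 1` ON THE BALL**: `(ρ + S_j/2)·L ≤ R·S_j ⟹ j ≤ lev w + 1` for every chart site within `ρ` of the centre ((2.2) at level `j − 1` between
`w` and the witness: `R·S_j/L = R·M·L^{j−1} < |w − wit| ≤ ρ + S_j/2` would follow otherwise). [cite: Balaban1984PropagatorsII, (2.2) p.224] -/
theorem lev_ge_of_dist_le (hMh : 1 ≤ Mh) (hP4 : ∀ μ, 4 ≤ P μ) (c : ↥(B6Cover236MultiLevelBlocksL0.cubes D.toDomains)) {ρ : ℝ}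
    (hρ : (ρ + (bigSide ℓ Mh c.1.1 : ℝ) / 2) * ((ℓ : ℝ) + 1) ≤ (R : ℝ) * (bigSide ℓ Mh c.1.1 : ℝ)) {w : ↥(boxDom (N0 ℓ Mh k P))}
    (hw : dist (toR w.1) (ctr (Dch D c) (cc D hMh hP4 c)) ≤ ρ) : c.1.1 ≤ (Dch D c).lev w.1 + 1 := by
  by_contra hlt
  push Not at hlt
  obtain ⟨i, hi⟩ : ∃ i, c.1.1 = i + 1 := ⟨c.1.1 - 1, by omega⟩
  have hlw : (Dch D c).lev (wit (Dch D c) (cc D hMh hP4 c)).1 = c.1.1 := lev_wit (Dch D c) (cc D hMh hP4 c)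
  have hsep := (Dch D c).sep i w.1 w.2 (wit (Dch D c) (cc D hMh hP4 c)).1 (wit (Dch D c) (cc D hMh hP4 c)).2 (by omega) (by omega)
  have hnear := supNorm_sub_wit_le hMh hP4 c hw
  have eS : (bigSide ℓ Mh c.1.1 : ℝ) = ((ℓ : ℝ) + 1) * (bigSide ℓ Mh i : ℝ) := by rw [hi, bigSide_succ]; push_cast; ring
  have e1 : ((R * bigSide ℓ Mh i : ℕ) : ℝ) = (R : ℝ) * (bigSide ℓ Mh i : ℝ) := by push_cast; ring
  rw [e1] at hsep
  rw [eS] at hρ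
  have hL : (0 : ℝ) < (ℓ : ℝ) + 1 := by positivity
  have hb : (0 : ℝ) ≤ (bigSide ℓ Mh i : ℝ) := by positivity
  -- `(ρ + S/2)·L ≤ R·L·S_i` gives `ρ + S/2 ≤ R·S_i < |w − wit| ≤ ρ + S/2`
  have h1 : ρ + ((ℓ : ℝ) + 1) * (bigSide ℓ Mh i : ℝ) / 2 ≤ (R : ℝ) * (bigSide ℓ Mh i : ℝ) := by
    have := hρ; nlinarith
  linarith

/-- **LEVELS `≤ j + 1` ON THE BALL**: `(ρ + S_j/2)·L ≤ R·S_j ⟹ lev w ≤ j + 1` ((2.2) at level `j + 1` between the witness and `w`).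
[cite: Balaban1984PropagatorsII, (2.2) p.224, p.230 («intersecting maybe the domain B^{j+1}(Λ_{j+1})»)] -/
theorem lev_le_of_dist_le (hMh : 1 ≤ Mh) (hP4 : ∀ μ, 4 ≤ P μ) (c : ↥(B6Cover236MultiLevelBlocksL0.cubes D.toDomains)) {ρ : ℝ}
    (hρ : (ρ + (bigSide ℓ Mh c.1.1 : ℝ) / 2) * ((ℓ : ℝ) + 1) ≤ (R : ℝ) * (bigSide ℓ Mh c.1.1 : ℝ)) {w : ↥(boxDom (N0 ℓ Mh k P))}
    (hw : dist (toR w.1) (ctr (Dch D c) (cc D hMh hP4 c)) ≤ ρ) : (Dch D c).lev w.1 ≤ c.1.1 + 1 := by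
  by_contra hlt
  push Not at hlt
  have hlw : (Dch D c).lev (wit (Dch D c) (cc D hMh hP4 c)).1 = c.1.1 := lev_wit (Dch D c) (cc D hMh hP4 c)
  have hsep := (Dch D c).sep (c.1.1 + 1) (wit (Dch D c) (cc D hMh hP4 c)).1 (wit (Dch D c) (cc D hMh hP4 c)).2 w.1 w.2 (by omega) (by omega)
  have hnear := supNorm_sub_wit_le hMh hP4 c hw
  have hsym : supNorm ((wit (Dch D c) (cc D hMh hP4 c)).1 - w.1) = supNorm (w.1 - (wit (Dch D c) (cc D hMh hP4 c)).1) := by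
    rw [supNorm_eq_dist, supNorm_eq_dist, dist_comm]
  rw [hsym] at hsep
  have eS : (bigSide ℓ Mh (c.1.1 + 1) : ℝ) = ((ℓ : ℝ) + 1) * (bigSide ℓ Mh c.1.1 : ℝ) := by rw [bigSide_succ]; push_cast; ring
  have e1 : ((R * bigSide ℓ Mh (c.1.1 + 1) : ℕ) : ℝ) = (R : ℝ) * (((ℓ : ℝ) + 1) * (bigSide ℓ Mh c.1.1 : ℝ)) := by rw [← eS]; push_cast; ring
  rw [e1] at hsep
  have hL : (1 : ℝ) ≤ (ℓ : ℝ) + 1 := by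
    have h : (0 : ℝ) ≤ ℓ := by positivity
    linarith
  have hb : (0 : ℝ) ≤ (bigSide ℓ Mh c.1.1 : ℝ) := by positivity
  have hR0 : (0 : ℝ) ≤ (R : ℝ) := by positivity
  -- `ρ + S/2 ≤ (ρ + S/2)·L ≤ R·S ≤ R·L·S < |w − wit| ≤ ρ + S/2`
  have h1 : ρ + (bigSide ℓ Mh c.1.1 : ℝ) / 2 ≤ (R : ℝ) * (bigSide ℓ Mh c.1.1 : ℝ) := by
    have hρ0 : 0 ≤ ρ := le_trans dist_nonneg hw
    nlinarith
  have h2 : (R : ℝ) * (bigSide ℓ Mh c.1.1 : ℝ) ≤ (R : ℝ) * (((ℓ : ℝ) + 1) * (bigSide ℓ Mh c.1.1 : ℝ)) := by nlinarith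
  linarith

/-- **NEVER BOTH `j − 1` AND `j + 1` ON THE BALL** ((2.2) at level `j` between the two sites: `R·S_j < 2ρ ≤ (ρ + S_j/2)·L`).
[cite: Balaban1984PropagatorsII, (2.2) p.224, p.235 («either □̃ ⊂ B^j(Λ_j), or it intersects B^{j+1}(Λ_{j+1}) also»)] -/
theorem not_both_sides_of_dist_le (hℓ : 1 ≤ ℓ) (hMh : 1 ≤ Mh) (hP4 : ∀ μ, 4 ≤ P μ) (c : ↥(B6Cover236MultiLevelBlocksL0.cubes D.toDomains)) {ρ : ℝ}
    (hρ : (ρ + (bigSide ℓ Mh c.1.1 : ℝ) / 2) * ((ℓ : ℝ) + 1) ≤ (R : ℝ) * (bigSide ℓ Mh c.1.1 : ℝ)) {w w' : ↥(boxDom (N0 ℓ Mh k P))}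
    (hw : dist (toR w.1) (ctr (Dch D c) (cc D hMh hP4 c)) ≤ ρ) (hw' : dist (toR w'.1) (ctr (Dch D c) (cc D hMh hP4 c)) ≤ ρ)
    (hl : (Dch D c).lev w.1 + 1 = c.1.1) (hl' : (Dch D c).lev w'.1 = c.1.1 + 1) : False := by
  have hsep := (Dch D c).sep c.1.1 w.1 w.2 w'.1 w'.2 (by omega) (by omega)
  have e1 : ((R * bigSide ℓ Mh c.1.1 : ℕ) : ℝ) = (R : ℝ) * (bigSide ℓ Mh c.1.1 : ℝ) := by push_cast; ring
  rw [e1, supNorm_eq_dist] at hsep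
  have htri : dist (toR w.1) (toR w'.1) ≤ 2 * ρ := by
    linarith [dist_triangle_right (toR w.1) (toR w'.1) (ctr (Dch D c) (cc D hMh hP4 c))]
  have hL : (2 : ℝ) ≤ (ℓ : ℝ) + 1 := by
    have h : (1 : ℝ) ≤ ℓ := by exact_mod_cast hℓ
    linarith
  have hb : (0 : ℝ) ≤ (bigSide ℓ Mh c.1.1 : ℝ) := by positivity
  have hρ0 : 0 ≤ ρ := le_trans dist_nonneg hw
  nlinarith

/-- **THE TWO-LEVEL WINDOW OF THE `ρ`-BALL**: if `(ρ + S_j/2)·L ≤ R·S_j` then there is `j₀ ∈ {j − 1, j}` such that every chart site within `ρ` of the centre of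
the central cube has chart level `j₀` or `j₀ + 1` (the torus level of `σ_c w` is this chart level, file 3's `lev_σch`) — r03's `hlev` on a member window of any
size, given (2.2) with `R` that large. [cite: Balaban1984PropagatorsII, (2.2) p.224, p.230, p.238 («we take the cube □̃³ and identify it with a torus T_□»)] -/
theorem two_level_ball (hℓ : 1 ≤ ℓ) (hMh : 1 ≤ Mh) (hP4 : ∀ μ, 4 ≤ P μ) (c : ↥(B6Cover236MultiLevelBlocksL0.cubes D.toDomains)) {ρ : ℝ}
    (hρ : (ρ + (bigSide ℓ Mh c.1.1 : ℝ) / 2) * ((ℓ : ℝ) + 1) ≤ (R : ℝ) * (bigSide ℓ Mh c.1.1 : ℝ)) :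
    ∃ j₀ : ℕ, (j₀ + 1 = c.1.1 ∨ j₀ = c.1.1) ∧ ∀ w : ↥(boxDom (N0 ℓ Mh k P)),
      dist (toR w.1) (ctr (Dch D c) (cc D hMh hP4 c)) ≤ ρ → j₀ ≤ (Dch D c).lev w.1 ∧ (Dch D c).lev w.1 ≤ j₀ + 1 := by
  by_cases hdown : ∃ w₀ : ↥(boxDom (N0 ℓ Mh k P)), dist (toR w₀.1) (ctr (Dch D c) (cc D hMh hP4 c)) ≤ ρ ∧ (Dch D c).lev w₀.1 + 1 = c.1.1
  · obtain ⟨w₀, hw₀, hl₀⟩ := hdown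
    refine ⟨c.1.1 - 1, Or.inl (by omega), fun w hw => ?_⟩
    have h1 := lev_ge_of_dist_le hMh hP4 c hρ hw
    have hne : (Dch D c).lev w.1 ≠ c.1.1 + 1 := fun h => not_both_sides_of_dist_le hℓ hMh hP4 c hρ hw₀ hw hl₀ h
    have h2 := lev_le_of_dist_le hMh hP4 c hρ hw
    constructor <;> omega
  · push Not at hdown
    refine ⟨c.1.1, Or.inr rfl, fun w hw => ?_⟩
    have h1 := lev_ge_of_dist_le hMh hP4 c hρ hw
    have h2 := lev_le_of_dist_le hMh hP4 c hρ hw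
    have hne := hdown w hw
    constructor <;> omega

/-! ## §2  The depth of a ball around the central cube -/

/-- **THE `ρ`-BALL IS `w`-DEEP WHEN `ρ + w` FITS UNDER THE CENTRE BOUNDS**: `ρ + w ≤ 2S_k + S_j/2` (below) and `ρ + w ≤ (P_μ − 3)S_k + S_j/2` (above) make every
chart site within `ρ` of the centre of the central cube `w`-deep (file 3's `ctr_cc_bounds`; `siteDeep_of_dist_le` is the case `ρ = 3S_j/2`, `w = S_k`, `P ≥ 5`).
[cite: Balaban1984PropagatorsII, (2.36) p.229 with (2.46) p.231, dictionary (charts)] -/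
theorem siteDeep_of_dist_le_of_room (hMh : 1 ≤ Mh) (hP4 : ∀ μ, 4 ≤ P μ) (c : ↥(B6Cover236MultiLevelBlocksL0.cubes D.toDomains)) {ρ : ℝ} {w : ℤ}
    (hlo : ρ + (w : ℝ) ≤ 2 * (bigSide ℓ Mh k : ℝ) + (bigSide ℓ Mh c.1.1 : ℝ) / 2)
    (hhi : ∀ μ, ρ + (w : ℝ) ≤ ((P μ : ℝ) - 3) * (bigSide ℓ Mh k : ℝ) + (bigSide ℓ Mh c.1.1 : ℝ) / 2)
    {x : ↥(boxDom (N0 ℓ Mh k P))} (h : dist (toR x.1) (ctr (Dch D c) (cc D hMh hP4 c)) ≤ ρ) :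
    SiteDeep (N0 ℓ Mh k P) w x.1 := by
  intro μ
  obtain ⟨h1, h2⟩ := ctr_cc_bounds hMh hP4 c μ
  have hμ := (dist_le_pi_dist (toR x.1) _ μ).trans h
  rw [Real.dist_eq, abs_le] at hμ
  have ex : toR x.1 μ = (x.1 μ : ℝ) := rfl
  rw [ex] at hμ
  have hhiμ := hhi μ
  have hlo' : ((w : ℤ) : ℝ) ≤ ((x.1 μ : ℤ) : ℝ) := by linarith [hμ.1]
  have hhi' : ((x.1 μ + w : ℤ) : ℝ) ≤ (((N0 ℓ Mh k P μ : ℕ) : ℤ) : ℝ) := by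
    rw [Int.cast_add, Int.cast_natCast]; linarith [hμ.2]
  exact ⟨Int.cast_le.1 hlo', Int.cast_le.1 hhi'⟩

/-- **A BLOCK WHOSE SITES LIE IN THE BALL IS `w`-DEEP** under the same room hypotheses. [cite: Balaban1984PropagatorsII, (2.45) p.231, dictionary (charts)] -/
theorem blkDeep_of_room (hMh : 1 ≤ Mh) (hP4 : ∀ μ, 4 ≤ P μ) (c : ↥(B6Cover236MultiLevelBlocksL0.cubes D.toDomains)) {ρ : ℝ} {w : ℤ}
    (hlo : ρ + (w : ℝ) ≤ 2 * (bigSide ℓ Mh k : ℝ) + (bigSide ℓ Mh c.1.1 : ℝ) / 2)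
    (hhi : ∀ μ, ρ + (w : ℝ) ≤ ((P μ : ℝ) - 3) * (bigSide ℓ Mh k : ℝ) + (bigSide ℓ Mh c.1.1 : ℝ) / 2)
    {b : ↥(bset (Dch D c))} (hb : ∀ x : ↥(boxDom (N0 ℓ Mh k P)), blkOf (Dch D c) x = b → dist (toR x.1) (ctr (Dch D c) (cc D hMh hP4 c)) ≤ ρ) :
    BlkDeep (Dch D c) w b :=
  fun x hx => siteDeep_of_dist_le_of_room hMh hP4 c hlo hhi (hb x hx)

end Literature.MathematicalPhysics.QuantumFieldTheory.Balaban1983to89.B6Partition118KLevelTorusWindowL0
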